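import Summits.BirchSwinnertonDyer.BirchSwinnertonDyer.Theorems.GenusKolyvaginAtTwoGenusPrimitiveSupplyAtTwoPrimeHeegnerTwinSilentPrimes
import Literature.NumberTheory.EllipticCurves.ModTwoReducibleIffTwoTorsionRoot
import Literature.NumberTheory.EllipticCurves.ModPReducibilityProofs
import Literature.NumberTheory.EllipticCurves.TwoAdicImageQuadraticTwistProofs
import HarnessLib

/-!
# Route `GenusKolyvaginAtTwo`, crux #2 `GenusPrimitiveSupplyAtTwo` (stmt-BirchSwinnertonDyer-22136):
# SILENT ADMISSIBLE PRIMES FOR EVERY `W` WITH `E(ℚ)[2] = 0` AND `Δ > 0` — the `C₃`-image (square `Δ`) locus included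

Width seat `bsd-line-gk2-p4` g15 (cell `bsd-f1-sign2`). THEOREMS ONLY (no definition, no named fact, no `sorry`); helper
`--supports stmt-BirchSwinnertonDyer-22136`; no item is closed; BSD is not proved by any of this.

WHY. gk2-p5's `GenusKolyTwin.exists_silent_prime_gt` / `exists_silent_prime_heegnerField` supply silent admissible primes `ℓ ≡ 7 (mod 8)`,
`ℓ ≡ −1 (mod p ∣ N_W)` for `Δ_W > 0` under `ρ̄_{W,2}` ONTO (witness `c₀·[x, y]`, a commutator). On the `C₃`-image locus (`Δ_W` a square,
`E(ℚ)[2] = 0`) commutators act trivially on `E[2]` and the class `ℓ ≡ −1 (mod p)` may even be forced to be an identity prime; but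
`F1Sign2.DescAdmissible W (−ℓ)` only asks `(−ℓ/p) = 1` at the odd bad `p`. NEW WITNESS `γ₀ = c₀ · τ²` with `τ` ANY element moving every
non-zero point of `E[2]` (exists iff `E[2]` is irreducible iff `E(ℚ)[2] = 0`, tree `not_irreducible_of_forall_exists_smul_eq` +
`not_hasIrreducibleModPGaloisRep_two_iff_exists_isRoot_twoTorsionPolynomial`): `τ²` again moves every non-zero point (`2E[2] = 0`), `c₀` fixes
`E[2]` (`Δ > 0`), and `χ_m(γ₀) = −χ_m(τ)²` is MINUS A SQUARE — so the Čebotarev prime has `ℓ ≡ −s² (mod 8 N_W)`: `ℓ ≡ 7 (mod 8)` and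
`(−ℓ/p) = (s²/p) = 1`. The rest of gk2-p5's proof (Frobenius density, cyclotomic character of a Frobenius, inertia trivial on `E[2]`,
`#Ẽ(𝔽_ℓ)` odd) is re-run VERBATIM.

* §56 `hasIrreducibleModPGaloisRep_two_of_noRationalTwoTorsion`, `exists_smul_ne_of_noRationalTwoTorsion`, `sq_smul_ne_of_smul_ne`;
* §57 `exists_silent_prime_gt_of_noRationalTwoTorsion` — `Δ_W > 0`, `E(ℚ)[2] = 0`, any bound `b` ⟹ a prime `ℓ > b`, `ℓ ≡ 7 (mod 8)`, `ℓ ∤ N_W`,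
  `(−ℓ/p) = 1` at every odd `p ∣ N_W`, SILENT (no root of the `2`-division cubic mod `ℓ`);
* §58 `exists_descAdmissible_neg_prime_of_noRationalTwoTorsion` — hence `F1Sign2.DescAdmissible W (−ℓ)` beyond every bound, for EVERY globally
  minimal `W` with `Δ_W > 0` and `E(ℚ)[2] = 0` (no image hypothesis).

Consumer: `…DoorSupplyPosDiscAll` (the `Δ > 0` door supply for every odd `2`-Selmer dimension WITHOUT `Δ ∉ ℚ²`, hence `DoorSupplyAtTwo` by name
modulo the finiteness of `Ш`). References: Serre, *Abelian ℓ-adic representations* I §2.2 Cor. 2; Silverman *AEC* III.2.3, VII.3.1(b), VII.4.1(a);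
Kramer 1981 Prop. 6; Mazur–Rubin 2010 Lemma 3.5.
-/

set_option linter.dupNamespace false -- tree convention: `Summit.BirchSwinnertonDyer.BirchSwinnertonDyer.Theorems` (summit = sub-problem)
set_option autoImplicit false

noncomputable section

open scoped Classical

namespace Summit.BirchSwinnertonDyer.BirchSwinnertonDyer.Theorems.GenusKolyTransp

open NumberField WeierstrassCurve Field IsDedekindDomain
open Literature.NumberTheory.EllipticCurves Literature.NumberTheory.GaloisRepresentations
open Summit.BirchSwinnertonDyer.BirchSwinnertonDyer.Theorems.GenusKolySign (twoTorsion_smul_eq_of_Δ_pos)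
open Summit.BirchSwinnertonDyer.BirchSwinnertonDyer.Theorems.GenusKolyTwin (silent_iff_odd_frobeniusTrace forall_two_nsmul_eq_zero_iff_odd_natCard
  dvd_conductorNorm_of_dvd_minimalDiscriminantInt)
open Summit.BirchSwinnertonDyer.Rank1Residual.F1Sign2

variable (W : WeierstrassCurve ℚ) [W.IsElliptic] [W.IsGloballyMinimal]

/-! ## §56 `E(ℚ)[2] = 0` ⟹ `E[2]` irreducible ⟹ an element of `Γ_ℚ` moving every non-zero `2`-torsion point -/

omit [W.IsGloballyMinimal] in
/-- **`E(ℚ)[2] = 0` ⟹ `E[2]` is an irreducible `Γ_ℚ`-module** (no rational root of the `2`-division cubic; tree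
`not_hasIrreducibleModPGaloisRep_two_iff_exists_isRoot_twoTorsionPolynomial`). [cite: SilvermanAEC2009, Prop. III.2.3 and Exercise 3.7(b)] -/
theorem hasIrreducibleModPGaloisRep_two_of_noRationalTwoTorsion (hT : NoRationalTwoTorsion W) : W.HasIrreducibleModPGaloisRep 2 := by
  by_contra h
  obtain ⟨x₀, hx⟩ := (W.not_hasIrreducibleModPGaloisRep_two_iff_exists_isRoot_twoTorsionPolynomial).mp h
  refine hT x₀ ((hasRationalTwoTorsionX_iff_twoDivision W x₀).mpr ?_)
  have h' := hx
  simp only [Polynomial.IsRoot.def, Cubic.toPoly, WeierstrassCurve.twoTorsionPolynomial, Polynomial.eval_add, Polynomial.eval_mul,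
    Polynomial.eval_C, Polynomial.eval_pow, Polynomial.eval_X] at h'
  linear_combination h'

omit [W.IsGloballyMinimal] in
/-- **`E(ℚ)[2] = 0` ⟹ some `τ ∈ Γ_ℚ` moves every non-zero point of `E[2]`** (an element of order `3` on `E[2] ∖ 0`; tree
`not_irreducible_of_forall_exists_smul_eq`). [cite: SilvermanAEC2009, Prop. III.2.3] -/
theorem exists_smul_ne_of_noRationalTwoTorsion (hT : NoRationalTwoTorsion W) :
    ∃ τ : absoluteGaloisGroup ℚ, ∀ P : geomTorsion W ((2 : ℕ) : ℤ), P ≠ 0 → τ • P ≠ P := by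
  haveI : Fact (Nat.Prime 2) := ⟨Nat.prime_two⟩
  by_contra h
  push Not at h
  exact not_irreducible_of_forall_exists_smul_eq W 2 h (hasIrreducibleModPGaloisRep_two_of_noRationalTwoTorsion W hT)

/-- In a group killed by `2`, the square of a fixed-point-free automorphism is fixed-point free: if `τ²a = a` then `b = a + τa` is fixed by
`τ`, so `b = 0`, so `τa = a`. [folklore] -/
theorem sq_smul_ne_of_smul_ne {G A : Type*} [Group G] [AddCommGroup A] [DistribMulAction G A] (h2 : ∀ a : A, a + a = 0) {τ : G}
    (hτ : ∀ a : A, a ≠ 0 → τ • a ≠ a) : ∀ a : A, a ≠ 0 → (τ ^ 2) • a ≠ a := by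
  intro a ha h
  have hb : τ • (a + τ • a) = a + τ • a := by
    rw [smul_add, ← mul_smul, ← pow_two, h, add_comm]
  have hb0 : a + τ • a = 0 := by
    by_contra hne
    exact hτ _ hne hb
  have hτa : τ • a = a := by
    have := congrArg (fun x => x + τ • a) (h2 (τ • a))
    simp only [zero_add] at this
    -- `a + τa = 0` and `τa + τa = 0` give `τa = a`
    have h1 : a + τ • a = τ • a + τ • a := by rw [hb0, h2]
    exact (add_right_cancel h1).symm
  exact hτ a ha hτa

/-! ## §57 Silent admissible primes from `E(ℚ)[2] = 0` alone (Čebotarev, proved in the tree) -/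

/-- **Silent primes with `ℓ ≡ 7 (mod 8)` and `(−ℓ/p) = 1` at the odd bad `p` exist beyond every bound, for every `W` with `Δ_W > 0` and
`E(ℚ)[2] = 0`** (no hypothesis on the image of `ρ̄_{W,2}`: `S₃` and `C₃` alike). Witness `γ₀ = c₀ · τ²` (`τ` moving every non-zero `2`-torsion point,
`c₀` a complex conjugation — trivial on `E[2]` as `Δ > 0` — so `χ_{8N}(γ₀) = −χ_{8N}(τ)²` is minus a square); then gk2-p5's proof of
`GenusKolyTwin.exists_silent_prime_gt` VERBATIM: Frobenius density in the neighbourhood «same action on `E[2]`, same `χ_{8N}`», the cyclotomic character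
of a Frobenius, inertia trivial on `E[2]` at a good odd prime, `#Ẽ(𝔽_ℓ)` odd. [cite: SerreAbelianLadic1968, Ch. I §2.2, Cor. 2 (a)]
[cite: SilvermanAEC2009, Prop. VII.3.1(b), Prop. VII.4.1(a), III.2.3] -/
theorem exists_silent_prime_gt_of_noRationalTwoTorsion (hΔ : 0 < W.Δ) (hT : NoRationalTwoTorsion W) (b : ℕ) :
    ∃ ℓ : ℕ, b < ℓ ∧ ℓ.Prime ∧ ℓ % 8 = 7 ∧ ¬ ℓ ∣ W.conductorNorm ℤ ∧
      (∀ p : ℕ, p.Prime → p ∣ W.conductorNorm ℤ → p ≠ 2 → jacobiSym (-(ℓ : ℤ)) p = 1) ∧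
      ∀ x : ZMod ℓ, 4 * x ^ 3 + ((integralModelInt W).b₂ : ZMod ℓ) * x ^ 2 +
        2 * ((integralModelInt W).b₄ : ZMod ℓ) * x + ((integralModelInt W).b₆ : ZMod ℓ) ≠ 0 := by
  classical
  -- the modulus `m = 8 N`
  set N : ℕ := W.conductorNorm ℤ with hN
  have hN0 : N ≠ 0 := (W.conductorNorm_pos_holds).ne'
  set m : ℕ := 8 * N with hm
  have hm0 : m ≠ 0 := by positivity
  haveI : NeZero m := ⟨hm0⟩
  haveI : NeZero (m : ℚ) := ⟨by exact_mod_cast hm0⟩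
  -- the witness `γ₀ = c₀ · τ²`
  obtain ⟨τ, hτ⟩ := exists_smul_ne_of_noRationalTwoTorsion W hT
  have h2 : ∀ P : geomTorsion W ((2 : ℕ) : ℤ), P + P = 0 := fun P => by
    have hP : ((2 : ℕ) : ℤ) • (P : geomPoints W) = 0 := (mem_geomTorsion_iff W ((2 : ℕ) : ℤ) _).mp P.2
    apply Subtype.ext
    show (P : W.geomPoints) + P = 0
    rw [← two_zsmul]
    exact_mod_cast hP
  have hτ2 := sq_smul_ne_of_smul_ne h2 hτ
  obtain ⟨c₀, hc₀⟩ := exists_isComplexConjugation (Rat.castHom ℝ)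
  set γ₀ : absoluteGaloisGroup ℚ := c₀ * τ ^ 2 with hγ₀
  set χ := modNCyclotomicCharacter ℚ m with hχ
  set a : (ZMod m)ˣ := χ τ with ha
  have hχγ₀ : ((χ γ₀ : (ZMod m)ˣ) : ZMod m) = -((a : ZMod m) ^ 2) := by
    rw [hγ₀, map_mul, map_pow, Units.val_mul, Units.val_pow_eq_pow_val, modNCyclotomicCharacter_of_isComplexConjugation hc₀]
    ring
  have hγ₀P : ∀ P : geomTorsion W ((2 : ℕ) : ℤ), P ≠ 0 → γ₀ • P ≠ P := fun P hP h => by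
    rw [hγ₀, mul_smul, twoTorsion_smul_eq_of_Δ_pos W hΔ hc₀] at h
    exact hτ2 P hP h
  -- the neighbourhood `T` of `γ₀`: same action on `E[2]`, same value of `χ_m`
  set T : Set (absoluteGaloisGroup ℚ) :=
    {σ | (∀ P : geomTorsion W 2, σ • P = γ₀ • P) ∧ χ σ = χ γ₀} with hT'
  have hTnhds : T ∈ nhds γ₀ := by
    have hK : ((torsionFixing W 2 : Set (absoluteGaloisGroup ℚ)) ∩ {σ' | χ σ' = 1}) ∈
        nhds (1 : absoluteGaloisGroup ℚ) :=
      Filter.inter_mem ((isOpen_torsionFixing W two_ne_zero).mem_nhds (one_mem _))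
        (modNCyclotomicCharacter_eventually_eq_one ℚ m)
    have hcont : Continuous fun σ : absoluteGaloisGroup ℚ => γ₀⁻¹ * σ := continuous_const_mul γ₀⁻¹
    have hK' : ((torsionFixing W 2 : Set (absoluteGaloisGroup ℚ)) ∩ {σ' | χ σ' = 1}) ∈
        nhds ((fun σ : absoluteGaloisGroup ℚ => γ₀⁻¹ * σ) γ₀) := by
      simpa only [inv_mul_cancel] using hK
    refine Filter.mem_of_superset (hcont.continuousAt.preimage_mem_nhds hK') ?_
    rintro σ ⟨h1, h2'⟩
    refine ⟨fun P => ?_, ?_⟩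
    · have h1' := (mem_torsionFixing_iff W 2).mp h1 P
      rw [mul_smul, inv_smul_eq_iff] at h1'
      exact h1'
    · have h2'' : χ (γ₀⁻¹ * σ) = 1 := h2'
      rw [map_mul, map_inv, inv_mul_eq_one] at h2''
      exact h2''.symm
  -- the finite set of excluded places
  set B : ℕ := b + m + 3 with hB
  set S : Set (HeightOneSpectrum (𝓞 ℚ)) :=
    {v | ((Rat.HeightOneSpectrum.primesEquiv v : Nat.Primes) : ℕ) < B} with hS
  have hSfin : S.Finite := by
    refine Set.Finite.preimage
      (f := fun v : HeightOneSpectrum (𝓞 ℚ) => ((Rat.HeightOneSpectrum.primesEquiv v : Nat.Primes) : ℕ))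
      ?_ (Set.finite_Iio B)
    exact (Subtype.val_injective.comp Rat.HeightOneSpectrum.primesEquiv.injective).injOn
  -- Čebotarev: a Frobenius in `T` outside `S`
  obtain ⟨γ, ⟨v, hvS, 𝔓, h𝔓, hγ⟩, hγP, hγχ⟩ :=
    (absoluteGaloisGroup.frobenius_dense Literature.NumberTheory.Automorphic.chebotarev_artinRep_holds ℚ S hSfin).inter_nhds_nonempty
      hTnhds
  -- the prime `ℓ` under `v`
  obtain ⟨ℓ, hℓ, hℓv⟩ := exists_prime_natCast_mem v
  have hvℓ : ((Rat.HeightOneSpectrum.primesEquiv v : Nat.Primes) : ℕ) = ℓ :=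
    Rat.HeightOneSpectrum.primesEquiv_eq_of_natCast_mem v hℓ hℓv
  have hℓB : B ≤ ℓ := by
    have : ¬ ((Rat.HeightOneSpectrum.primesEquiv v : Nat.Primes) : ℕ) < B := hvS
    rw [hvℓ] at this
    exact not_lt.mp this
  have hℓ2 : ℓ ≠ 2 := by omega
  haveI := Fact.mk hℓ
  -- (a) the cyclotomic conditions: `χ_m(γ) = ℓ = χ_m(γ₀) = −a²`
  have hℓm : ¬ ℓ ∣ m := fun h => by
    have := Nat.le_of_dvd (Nat.pos_of_ne_zero hm0) h
    omega
  have hℓN : ¬ ℓ ∣ W.conductorNorm ℤ := fun h => hℓm (Dvd.dvd.mul_left h 8)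
  have hχγ : ((χ γ : (ZMod m)ˣ) : ZMod m) = (ℓ : ZMod m) := by
    rw [← hvℓ]
    exact Summit.BirchSwinnertonDyer.Rank1Residual.GaloisImage.CyclotomicLevel.Rat.modNCyclotomicCharacter_of_isArithFrobAtPlace
      (by rw [hvℓ]; exact hℓm) ⟨𝔓, h𝔓, hγ⟩
  have hℓmod : (ℓ : ZMod m) = -((a : ZMod m) ^ 2) := by rw [← hχγ, hγχ, hχγ₀]
  have hℓ8 : ℓ % 8 = 7 := by
    have h8 : (ℓ : ZMod 8) = -(((Units.map (ZMod.castHom (show 8 ∣ m from ⟨N, rfl⟩) (ZMod 8)).toMonoidHom a : (ZMod 8)ˣ) : ZMod 8) ^ 2) := by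
      have := congrArg (ZMod.castHom (show 8 ∣ m from ⟨N, rfl⟩) (ZMod 8)) hℓmod
      rw [map_natCast, map_neg, map_pow] at this
      rw [this, Units.coe_map]
      rfl
    have hsq : ∀ u : (ZMod 8)ˣ, -((u : ZMod 8) ^ 2) = ((7 : ℕ) : ZMod 8) := by decide
    rw [hsq] at h8
    exact (ZMod.natCast_eq_natCast_iff' ℓ 7 8).mp h8
  have hjac : ∀ p : ℕ, p.Prime → p ∣ W.conductorNorm ℤ → p ≠ 2 → jacobiSym (-(ℓ : ℤ)) p = 1 := by
    intro p hp hpN hp2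
    haveI := Fact.mk hp
    have hpm : p ∣ m := Dvd.dvd.mul_left hpN 8
    -- `−ℓ ≡ (ā)² (mod p)` with `ā` a unit
    set u : (ZMod p)ˣ := (Units.map (ZMod.castHom hpm (ZMod p)).toMonoidHom a) with hu
    have hℓp : ((-(ℓ : ℤ) : ℤ) : ZMod p) = (u : ZMod p) ^ 2 := by
      have := congrArg (ZMod.castHom hpm (ZMod p)) hℓmod
      rw [map_natCast, map_neg, map_pow] at this
      push_cast
      rw [this, neg_neg, hu, Units.coe_map]
      rfl
    have hne : ((-(ℓ : ℤ) : ℤ) : ZMod p) ≠ 0 := by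
      rw [hℓp]; exact pow_ne_zero 2 u.ne_zero
    rw [← jacobiSym.legendreSym.to_jacobiSym, legendreSym.eq_one_iff p hne, hℓp]
    exact ⟨u, sq (u : ZMod p)⟩
  refine ⟨ℓ, by omega, hℓ, hℓ8, hℓN, hjac, ?_⟩
  -- (b) the silent condition: `γ` moves every non-zero `2`-torsion point, hence `Ẽ(𝔽_ℓ)[2] = 0`
  have hℓΔ : ¬ (ℓ : ℤ) ∣ minimalDiscriminantInt W := fun h =>
    hℓN (dvd_conductorNorm_of_dvd_minimalDiscriminantInt W hℓ h)
  have hgoodℓ : W.HasGoodReductionAtPrime ℓ := hasGoodReductionAtPrime_of_not_dvd W ℓ hℓΔ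
  obtain ⟨σ₀, 𝔓₀, h𝔓₀, hσ₀, hcount⟩ :=
    Summit.BirchSwinnertonDyer.Rank1Residual.GaloisImage.FrobShape.exists_frobenius_natCard_fixed_eq
      W 2 ℓ hℓ2 hgoodℓ hℓv
  obtain ⟨g, hg⟩ := HeightOneSpectrum.exists_smul_eq_of_mem_primesAbove_holds h𝔓₀ h𝔓
  have hσ₁ : IsArithFrobAt (𝓞 ℚ) (g * σ₀ * g⁻¹) 𝔓 := hg ▸ hσ₀.conj g
  have hI := hγ.mul_inv_mem_inertia hσ₁
  have hgood : W.HasGoodReductionAt v := (hasGoodReductionAtPrime_primesEquiv_iff_holds W v ℓ hvℓ).mp hgoodℓ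
  have h2v : (2 : 𝓞 ℚ) ∉ v.asIdeal := fun h2m =>
    hℓ2 (hvℓ.symm.trans (Rat.HeightOneSpectrum.primesEquiv_eq_of_natCast_mem v Nat.prime_two (by exact_mod_cast h2m)))
  have h2v' : ((((2 : ℕ) : ℤ)) : 𝓞 ℚ) ∉ v.asIdeal := by
    rw [Int.cast_natCast]; exact_mod_cast h2v
  have hσσ₁ : ∀ P : geomTorsion W ((2 : ℕ) : ℤ), γ • P = (g * σ₀ * g⁻¹) • P := fun P => by
    have h' := W.smul_geomTorsion_eq_of_mem_inertia hgood h2v' h𝔓 hI ((g * σ₀ * g⁻¹) • P)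
    rwa [mul_smul, inv_smul_smul] at h'
  -- `σ₀` fixes only `0` on `E[2]`
  have hall : ∀ P : geomTorsion W ((2 : ℕ) : ℤ), σ₀ • P = P → P = 0 := fun P hfix => by
    by_contra hP
    have h' : (g * σ₀ * g⁻¹) • (g • P) = g • P := by
      rw [mul_smul, mul_smul, inv_smul_smul, hfix]
    rw [← hσσ₁, hγP] at h'
    exact hγ₀P (g • P) (fun h0 => hP (by simpa using congrArg (fun Q => g⁻¹ • Q) h0)) h'
  have hc1 := hcount 1
  rw [pow_one] at hc1
  have hfix1 : Nat.card {P : geomTorsion W ((2 : ℕ) : ℤ) // σ₀ • P = P} = 1 := by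
    rw [Nat.card_eq_one_iff_unique]
    exact ⟨⟨fun a' b' => Subtype.ext ((hall a'.1 a'.2).trans (hall b'.1 b'.2).symm)⟩, ⟨⟨0, smul_zero σ₀⟩⟩⟩
  rw [hfix1] at hc1
  -- hence `#Ẽ_v(k_v)` is odd, i.e. `a_ℓ` is odd, i.e. `ℓ` is silent
  have hc : Nat.card (W.reductionAt v).toAffine.Point = reductionPointCount W ℓ := by
    rw [← hvℓ]
    exact natCard_point_reduction_minimal_baseChange v W
  haveI : Finite (W.reductionAt v).toAffine.Point := by
    refine Nat.finite_of_card_ne_zero ?_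
    rw [hc, reductionPointCount]
    haveI : NeZero ℓ := ⟨hℓ.ne_zero⟩
    exact Nat.card_pos.ne'
  have hodd : Odd (Nat.card (W.reductionAt v).toAffine.Point) := by
    refine (forall_two_nsmul_eq_zero_iff_odd_natCard (A := (W.reductionAt v).toAffine.Point)).mp fun Q hQ => ?_
    have hmem : Q ∈ AddSubgroup.torsionBy (W.reductionAt v).toAffine.Point ((2 : ℕ) : ℤ) := by
      rw [Submodule.mem_toAddSubgroup, Submodule.mem_torsionBy_iff, Nat.cast_ofNat, two_zsmul, ← two_nsmul]
      exact hQ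
    haveI := (Nat.card_eq_one_iff_unique.mp hc1.symm).1
    have h0 : (⟨Q, hmem⟩ : AddSubgroup.torsionBy (W.reductionAt v).toAffine.Point ((2 : ℕ) : ℤ)) =
        ⟨0, AddSubgroup.zero_mem _⟩ := Subsingleton.elim _ _
    exact congrArg Subtype.val h0
  rw [hc] at hodd
  have hoddTr : Odd (W.frobeniusTrace ℓ) := by
    have h1 : Even ((ℓ : ℤ) + 1) := by
      obtain ⟨k, hk⟩ := hℓ.odd_of_ne_two hℓ2
      exact ⟨k + 1, by push_cast [hk]; ring⟩
    rw [WeierstrassCurve.frobeniusTrace, Int.odd_sub']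
    exact iff_of_true (by exact_mod_cast hodd) h1
  exact (silent_iff_odd_frobeniusTrace W hℓ2 hℓΔ).mpr hoddTr

/-! ## §58 A descent-admissible silent prime for every `W` with `Δ > 0`, `E(ℚ)[2] = 0` -/

/-- **`F1Sign2.DescAdmissible W (−ℓ)` for a silent prime `ℓ ≡ 7 (mod 8)`, `(−ℓ/p) = 1` at the odd bad `p`, `ℓ ∤ N_W`.**
[cite: Kramer1981, Prop. 6] [cite: MazurRubin2010, Lemma 2.2 (i)] -/
theorem descAdmissible_neg_prime_of_silent_of_jacobiSym {ℓ : ℕ} (hℓ : ℓ.Prime) (hℓ8 : ℓ % 8 = 7) (hℓN : ¬ ℓ ∣ W.conductorNorm ℤ)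
    (hjac : ∀ p : ℕ, p.Prime → p ∣ W.conductorNorm ℤ → p ≠ 2 → jacobiSym (-(ℓ : ℤ)) p = 1)
    (hsilent : ∀ x : ZMod ℓ, 4 * x ^ 3 + ((integralModelInt W).b₂ : ZMod ℓ) * x ^ 2 +
        2 * ((integralModelInt W).b₄ : ZMod ℓ) * x + ((integralModelInt W).b₆ : ZMod ℓ) ≠ 0) :
    DescAdmissible W (-(ℓ : ℤ)) := by
  haveI := Fact.mk hℓ
  have hℓ2 : ℓ ≠ 2 := by omega
  have hℓΔ : ¬ (ℓ : ℤ) ∣ minimalDiscriminantInt W := fun h => hℓN (dvd_conductorNorm_of_dvd_minimalDiscriminantInt W hℓ h)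
  have hℓ8' : (ℓ : ℤ) % 8 = 7 := by exact_mod_cast hℓ8
  refine ⟨by have := hℓ.pos; omega, ?_, by omega, ?_, ?_⟩
  · rw [← Int.squarefree_natAbs]
    simpa using hℓ.squarefree
  · intro q hq hqd
    have hqℓ : q = ℓ := by
      have h' : (q : ℤ) ∣ (ℓ : ℤ) := Int.dvd_neg.mp hqd
      exact (Nat.prime_dvd_prime_iff_eq hq hℓ).mp (by exact_mod_cast h')
    subst hqℓ
    exact ⟨fun _ => hasGoodReductionAtPrime_of_not_dvd W q hℓΔ, (silent_iff_odd_frobeniusTrace W hℓ2 hℓΔ).mp hsilent⟩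
  · intro p hp hp2 hbad
    haveI := Fact.mk hp
    exact hjac p hp ((W.dvd_conductorNorm_iff_not_hasGoodReductionAtPrime p).mpr (hbad ⟨hp⟩)) hp2

/-- **Descent-admissible silent primes exist beyond every bound for EVERY globally minimal `W` with `Δ_W > 0` and `E(ℚ)[2] = 0`** (the
`C₃`-image locus included): `ℓ > b` prime, `ℓ ∤ N_W`, `F1Sign2.DescAdmissible W (−ℓ)`. [cite: SerreAbelianLadic1968, Ch. I §2.2, Cor. 2 (a)]
[cite: Kramer1981, Prop. 6] -/
theorem exists_descAdmissible_neg_prime_of_noRationalTwoTorsion (hΔ : 0 < W.Δ) (hT : NoRationalTwoTorsion W) (b : ℕ) :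
    ∃ ℓ : ℕ, b < ℓ ∧ ℓ.Prime ∧ ¬ ℓ ∣ W.conductorNorm ℤ ∧ DescAdmissible W (-(ℓ : ℤ)) := by
  obtain ⟨ℓ, hb, hℓ, hℓ8, hℓN, hjac, hsil⟩ := exists_silent_prime_gt_of_noRationalTwoTorsion W hΔ hT b
  exact ⟨ℓ, hb, hℓ, hℓN, descAdmissible_neg_prime_of_silent_of_jacobiSym W hℓ hℓ8 hℓN hjac hsil⟩

end Summit.BirchSwinnertonDyer.BirchSwinnertonDyer.Theorems.GenusKolyTransp

end
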